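import Summits.CriticalPhenomena.PercolationContinuityZ3.Theorems.PercNearOneGluingNoHeavyLowerTailSahiThreeCopyTwoPoint

/-!
# Sahi's three-function conjecture — the two-point reduction with the canonical weights `θ = f`

In the two-point reduction theorem (`tc_frontFn_nonneg_of_upSets`, `…SahiThreeCopyTwoPoint`) the weights `θ ≥ 0` split the diagonal mass
`2 f(e₁)` between the two forms `(N1)`, `(N2)`.  With the canonical choice `θ = f` the form `(N1)` is nonnegative FOR FREE, by three-copy Harris:
`N1 = N3(f·φψ; 1; 1) − N3(f; φψ; 1) ≥ 0` (`N1form_self_eq`, `N1form_self_nonneg`).  Hence 3C for the free slot `f` follows from the single family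
of four-term inequalities `(N2)_f`: `N3(f·1_V·1_W;1;1) + N3(f;1_V;1_W) ≥ N3(1_V; f·1_W; 1) + N3(1_W; f·1_V; 1)` over pairs of up-sets
(`tc_frontFn_nonneg_of_N2_self`).  [`(N2)_f` is NOT always true — it fails for 717 of the 2701 `S₄`-orbits of `(f, π)` on `{0,1}^4`, where the
certificates of `…TwoPointCertsK4` redistribute the Harris slack of `(N1)` instead — but where it holds it gives 3C with no certificate search.]
-/

namespace Summit.CriticalPhenomena.PercolationContinuityZ3.Theorems.SahiThreeCopy

open Finset Function Literature.Combinatorics.Sahi2008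
open scoped BigOperators

variable {k : ℕ}

/-- `(N1)` with `θ = f` is a Harris difference: `N1 = N3(f·(φψ); 1; 1) − N3(f; φψ; 1)`. [this work] -/
theorem N1form_self_eq (π : Fin k → ℕ) (f φ ψ : Pt k → ℝ) :
    N1form k π f (fun a _ _ => f a) φ ψ = N3 π (f * (φ * ψ)) 1 1 - N3 π f (φ * ψ) 1 := by
  unfold N1form
  rw [N3_eq_sum_triple, N3_eq_sum_triple, ← Finset.sum_sub_distrib]
  refine Finset.sum_congr rfl fun τ _ => ?_
  simp only [Pi.mul_apply, Pi.one_apply]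
  ring

/-- ★ `(N1)` with the canonical weights `θ = f` is nonnegative on nonnegative monotone level-functions (three-copy Harris). [this work] -/
theorem N1form_self_nonneg (π : Fin k → ℕ) {f φ ψ : Pt k → ℝ} (hf : ∀ x, 0 ≤ f x) (hfm : Monotone f) (hφ : ∀ x, 0 ≤ φ x) (hψ : ∀ x, 0 ≤ ψ x)
    (hφm : Monotone φ) (hψm : Monotone ψ) : 0 ≤ N1form k π f (fun a _ _ => f a) φ ψ := by
  rw [N1form_self_eq]
  have hφψ : ∀ x, 0 ≤ (φ * ψ) x := fun x => mul_nonneg (hφ x) (hψ x)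
  have hφψm : Monotone (φ * ψ) := fun x y hxy => mul_le_mul (hφm hxy) (hψm hxy) (hψ x) (hφ y)
  exact sub_nonneg.2 (N3_le_N3_mul k π f (φ * ψ) 1 hf hfm hφψ hφψm fun _ => zero_le_one)

/-- ★★ **3C from `(N2)_f` alone.**  If `N3(f·1_V·1_W;1;1) + N3(f;1_V;1_W) − N3(1_V; f·1_W; 1) − N3(1_W; f·1_V; 1) ≥ 0` for all up-sets `V, W` of the
front cube (the form `(N2)` with `θ = f`), then `0 ≤ c_{(π,b)}(frontFn f, G, H)` for every back profile `b` on a cube of any dimension and all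
nonnegative monotone `G, H`. [this work] -/
theorem tc_frontFn_nonneg_of_N2_self (k : ℕ) (π : Fin k → ℕ) {f : Pt k → ℝ} (hf : ∀ x, 0 ≤ f x) (hfm : Monotone f)
    (hS2 : ∀ V W : Finset (Pt k), IsUpperSet (V : Set (Pt k)) → IsUpperSet (W : Set (Pt k)) →
      0 ≤ N2form k π f (fun a _ _ => f a) (setInd V) (setInd W))
    {d : ℕ} (b : Fin d → ℕ) {G H : Pt (d + k) → ℝ} (hG : ∀ w, 0 ≤ G w) (hH : ∀ w, 0 ≤ H w) (hGm : Monotone G) (hHm : Monotone H) :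
    0 ≤ tc (appendProf k π b) (frontFn k f) G H :=
  tc_frontFn_nonneg_of_upSets k π f (fun a _ _ => f a) (fun a _ _ => hf a)
    (fun V W hV hW => N1form_self_nonneg π hf hfm (setInd_nonneg V) (setInd_nonneg W) (monotone_setInd hV) (monotone_setInd hW)) hS2
    b hG hH hGm hHm

/-- The form `(N2)` with `θ = f`, written with three-copy functionals. [this work] -/
theorem N2form_self_eq (π : Fin k → ℕ) (f φ ψ : Pt k → ℝ) :
    N2form k π f (fun a _ _ => f a) φ ψ = N3 π (f * (φ * ψ)) 1 1 + N3 π f φ ψ - N3 π φ (f * ψ) 1 - N3 π ψ (f * φ) 1 := by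
  unfold N2form
  rw [N3_eq_sum_triple, N3_eq_sum_triple, N3_eq_sum_triple, N3_eq_sum_triple, ← Finset.sum_add_distrib, ← Finset.sum_sub_distrib,
    ← Finset.sum_sub_distrib]
  refine Finset.sum_congr rfl fun τ _ => ?_
  simp only [Pi.mul_apply, Pi.one_apply]
  ring

end Summit.CriticalPhenomena.PercolationContinuityZ3.Theorems.SahiThreeCopy
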